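import Mathlib
import HarnessLib
import Summits.Langlands.Statement
import Summits.Langlands.Langlands.Theses.DepthPrimeSplit
import Summits.Langlands.Langlands.Theorems.DepthPrimeSplitClassicalityBoxCapture
import Literature.NumberTheory.Automorphic.UnramifiedHeckeLevel

/-!
# TameLevelSplit — decomp-langlands lens-3 («one certified translation + split beneath»), generation 35

TARGET (BY NAME, tree): LEV = `Summit.Langlands.Langlands.Theorems.BoxCapture.LevelIsolation` — the IDEA-NEEDED cell of g34's cut
CLASS ⟺ LEV ∧ WT ∧ HC of `Summit.Langlands.Langlands.Theses.DepthPrimeSplit.Classicality` (stmt-Langlands-25026, crux r5 of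
route-Langlands-DepthPrimeSplit; tree module `Theorems/DepthPrimeSplitClassicalityBoxCapture.lean`, p838982) — and, as a corollary, CLASS itself
re-associated.

THESIS.  It suffices to factor level isolation through the TAME LEVEL.  g34's LEV asks that an ℓ-adically convergent sequence of cuspidal
`π_r → ρ` be replaced by one of bounded CONDUCTOR at every place of `S`, including `v ∣ ℓ`; that conflates two mechanisms of opposite nature:
* away from `ℓ` the conductor of an approximant is a RESIDUAL invariant — the wild inertia group `P_v` is pro-`v`, `v ≠ ℓ`, so a depth-one
  congruence `ρ_r ≡ ρ (mod 𝔪)` already forces `ρ_r|_{P_v} ≅ ρ|_{P_v}` (Brauer theory for `ℓ'`-groups), whence `sw_v(ρ_r) = sw_v(ρ)` and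
  `a_v(π_r) = a_v(ρ_r) ≤ n + sw_v(ρ)` (Artin conductor = codim of inertia invariants + Swan; JPSS conductor = level of the new vector):
  the tame level is ISOLATED by `ρ` alone — piece TLI;
* at `v ∣ ℓ` the level is NOT an ℓ-adic invariant at all: it trades against the weight (Katz 1975, Hida 1986/1988: eigenforms of level
  `Np^m` are `p`-adic limits of eigenforms of level `N`; Emerton: completed cohomology of tame level `K^p` does not see `K_p`) — piece WLR.
THE ONE EQUIV (kernel, modulo nothing): LEV ⟺ TLI ∧ WLR (`levelIsolation_iff_tameWild`), through the second language
C^tame = `IsTameLevelProAutomorphic` («pro-automorphic of tame level `𝔪`»: ONE finite `S`, ONE nonzero ideal `𝔪`, and to every depth `r` an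
L-algebraic cuspidal `π_r` of level `𝔪·(ℓ)^{e_r}`, the wild exponent `e_r` FREE, `r`-close to `ρ` off `S`) — the tree-typed form of Emerton's
«pro-modular of tame level `N`» / Hida's «tame level `N`, `p`-power level arbitrary».  The dictionary lemma with content is the COMMON-LEVEL
normal form `levelBounded_iff_commonLevel` (a finite set of levels is one level: product of the nonzero members, `principalCongruenceLevel_mono`),
which is what makes C^lev ⟹ C^tame (`tame_of_levelBounded`) and hence LEV ⟹ TLI.
SPLIT BENEATH + RE-ASSOCIATION (kernel): with PCL = `TameLevelClassicality` (C^tame ⟹ C^box: «pro-automorphic of tame level `𝔪` and de Rham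
⟹ boxed», EXACTLY the shape of the print theorem Emerton 2011 Thm 1.2.4 / Kisin 2003 / Pan 2022 = tree fact
`Literature.NumberTheory.Automorphic.Pan2022_proModularDeRhamClassical_GL2Q`: classical of SOME level `Np^m` and SOME weight) one has
PCL ⟺ WLR ∧ WT (`tameLevelClassicality_iff`) and therefore CLASS ⟺ TLI ∧ PCL ∧ HC (`classicality_iff_tameCells`) beside g34's
CLASS ⟺ LEV ∧ WT ∧ HC, both refining to the four-rung ladder CLASS ⟺ TLI ∧ WLR ∧ WT ∧ HC (`classicality_iff_fourRungs`):
  C ⟹[TLI] C^tame ⟹[WLR] C^lev ⟹[WT] C^box ⟹[HC] captured.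
The point of the re-association: the wild level need NOT be removed before the weight is isolated — print removes both at once (level `Np^m`
in Emerton's theorem), so g34's IDEA-NEEDED content of LEV at `v ∣ ℓ` is absorbed by the open core, and what remains of LEV (TLI) is ATTACKABLE.

PIECES AND TAGS (all three ROOT-IMPLIED by kernel: `tameCells_of_langlands`; no EXCESS; none gives LEV, CLASS or `Langlands` on its own —
probes p0/p1, bc7 CLEAN):
* TLI `TameLevelIsolation` — crux · WEAKER (LEV ⟹ TLI by kernel; TLI ↛ LEV: WLR open for l₀ > 0) · ATTACKABLE modulo the host route's own
  (A)-side binders for the approximants (W⁺ `SatakeAvatarExistence` 17415, P(i) `PadicMemberCompatibility` 17534, L∤R `CompatibilityAwayFromLR`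
  18084) + named local facts (Artin–Swan conductor formula; `P_v`-rigidity = Brauer characters of `ℓ'`-groups; JPSS 1981 conductor/new vector;
  LLC preserves conductors) · PRINT for GL₂/ℚ, `ℓ` odd, `ρ` odd (approximants are then holomorphic of weight ≥ 1: Deligne 1971, Deligne–Serre
  1974, Carayol 1986; Carayol 1989 / Livné 1989 give the residual conductor comparison `N(ρ̄) ∣ N(f)` with bounded index outright) ·
  why it might fail: an approximant without a Galois avatar (irregular `π_r`, even Maass-type) has no Swan conductor to compare — the bound is
  conditional on (A) exactly there.
* WLR `WildLevelRemoval` — crux · WEAKER (LEV ⟹ WLR; WLR ↛ LEV: needs TLI) · the residual of LEV · PRINT in every setting with a `q`-expansion or a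
  model compact at infinity: GL₂/ℚ (Katz 1975 §II; Hida 1986 §1; Gouvêa LNM 1304 §I.3), GL₂ over totally real `F` (Hida, Ann. Math. 128 (1988)),
  definite unitary groups / definite quaternion algebras (Gross algebraic modular forms: locally algebraic vectors of all weights are dense in
  `C(G(ℚ)\G(𝔸_f)/K^p, E)` — Mahler/Stone–Weierstrass; Chenevier 2004, Emerton 2006 §§2–3) transported to GL_n by JL / polarized descent ·
  IDEA-NEEDED for `l₀ > 0` (e.g. GL₂ over an imaginary quadratic field: whether a Bianchi newform of level `𝔫𝔭^m` is congruent modulo every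
  `p^M` to Bianchi eigenforms of level `𝔫` is not known — no `q`-expansion principle across weights, completed cohomology in two degrees) ·
  BARRIER `Literature.Barriers.Langlands.ShimuraVarietyRealization*` (no Shimura variety / compact model for GL_n, `l₀ > 0`) · INSTRUMENTABLE
  (census: Bianchi level-`𝔫𝔭` newforms vs level-`𝔫` eigensystems mod `p^M`).
* PCL `TameLevelClassicality` — derived coarse cell (= WLR ∧ WT by kernel) · UNDECIDED-vs-CLASS (PCL ⟹ CLASS needs TLI ∧ HC; CLASS ⟹ PCL by kernel)
  · PRINT GL₂/ℚ: Emerton 2011 Thm 1.2.4 (`ρ̄` abs. irreducible, `p`-distinguished hypotheses), Kisin 2003 (finite slope), Pan 2022 (tree fact,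
  any `p`) — modulo the Eichler–Shimura bridge «C^tame ⟹ Emerton-pro-modular of tame level `N`» (cohomological approximants contribute to
  `H¹(Y₁(Np^m))`; weight-one approximants are `p`-adic limits of higher weight at level `N`, Deligne–Serre/Katz); polarized crystalline-generic
  regular GL_n over CM: Breuil–Hellmann–Schraen 2019 · OPEN-CORE in general · BARRIER `Literature.Barriers.Langlands.NonRegularWeight*`
  (irregular Hodge–Tate type, n ≥ 3).
WHY EACH PIECE IS STRICTLY WEAKER THAN ITS TARGET: TLI and WLR are each implied by LEV (kernel) and neither implies LEV as typed (the other is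
open: probes p1.1/p1.2 fail; mathematically WLR is open for `l₀ > 0` and TLI needs avatars of irregular approximants); PCL is implied by CLASS
(kernel) and does not give CLASS without TLI ∧ HC (probe p0.3).  WHY NOVEL (cell-relative): no node of the cell factors the level of the
approximating family into tame and wild parts — g34 LEV bounds the whole conductor in one step (IDEA-NEEDED because of `v ∣ ℓ`), the level lineage
g20/g24/g25/g28 (AuxiliaryLevelSplit U₁/U₂, TransientLevel, IwahoriTransient, BanalAuxiliarySplit) concerns AUXILIARY places outside `S_ρ` where
`ρ` is unramified (unipotent/tame transience), not the places of `S` and not `v ∣ ℓ`; the Swan-conductor-as-residual-invariant lever and the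
Katz–Hida level/weight exchange are new objects on this summit's tree; PCL identifies the print theorem's exact hypothesis shape (tame level)
inside the CLASS ladder.

FRAMES: `closes_levelIsolation : TLI → WLR → BoxCapture.LevelIsolation`; `closes_classicality_tame : TLI → PCL → HC → DepthPrimeSplit.Classicality`;
`closes_root_tame : D → O → F → TLI → PCL → HC → W⁺ → P → A → R → Langlands` (= `DepthPrimeSplit.closes` with CLASS discharged).
Typed-not-filed (Langlands route freeze 2026-08-31T07:10:57Z): census twin verb in RUNME.md (`--supports stmt-Langlands-25026 --as helper`).
-/

set_option linter.dupNamespace false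

namespace Summit.Langlands.Langlands.Theorems.TameLevelSplit

open scoped NumberField
open Filter Field IsDedekindDomain
open Literature.NumberTheory.GaloisRepresentations Literature.NumberTheory.Automorphic
open Summit.Langlands.Langlands.Theorems.TransientLevel
open Summit.Langlands.Langlands.Theorems.BoxCapture (HasLevel InBox IsLevelBoundedProAutomorphic IsBoxedProAutomorphic IsFinitelyCaptured
  LevelIsolation WeightIsolation HarishChandraCapture)
open Summit.Langlands.Langlands.Theses

/-! ## 1. Vocabulary — the second language: TAME LEVEL (C, C^lev, C^box, `HasLevel`, `CloseAt`, `IsPinnedGeometric` are the tree's, BY NAME) -/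

section Vocabulary

variable {K : Type} [Field K] [NumberField K] {n : ℕ} {ℓ : ℕ} [Fact ℓ.Prime]

/-- C^tame · PRO-AUTOMORPHIC OF TAME LEVEL `𝔪` (Emerton's «pro-modular of tame level `N`», Hida's «tame level `N`, `p`-power level free», in the
Satake-congruence currency of `DepthPrimeSplit`): ONE finite `S` and ONE nonzero ideal `𝔪` such that to every depth `r > 0` some L-algebraic
cuspidal `π_r` OF LEVEL `𝔪·(ℓ𝓞_K)^{e_r}` — the wild exponent `e_r` depending on `r` — is `r`-close to `ρ` at every `v ∉ S`. -/
def IsTameLevelProAutomorphic (hcpt : isCompact_glFiniteIntegralLevel n K) (ι : PadicAlgCl ℓ ≃+* ℂ)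
    (ρ : FramedGaloisRep K (PadicAlgCl ℓ) n) : Prop :=
  ∃ S : Set (HeightOneSpectrum (𝓞 K)), S.Finite ∧ ∃ 𝔪 : Ideal (𝓞 K), 𝔪 ≠ 0 ∧ ∀ r : NNReal, 0 < r →
    ∃ π : CuspidalAutomorphicRepData n K hcpt, π.1.IsLAlgebraic ∧ (∃ e : ℕ, HasLevel π (𝔪 * Ideal.span {(ℓ : 𝓞 K)} ^ e)) ∧
      ∀ v : HeightOneSpectrum (𝓞 K), v ∉ S → CloseAt ι π ρ r v

end Vocabulary

/-! ## 2. The items (Frame = LEV's = CLASS's binders and standing hypotheses VERBATIM; only the pro-automorphy hypothesis/conclusion changes) -/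

/-- TLI · TAME LEVEL ISOLATION · crux rank 3 · WEAKER · ATTACKABLE modulo the host route's (A)-side binders for the approximants (W⁺ 17415,
P 17534, L∤R 18084) + named local facts · PRINT GL₂/ℚ (`ℓ` odd, `ρ` odd).  Pro-automorphic with bounded bad set ⟹ pro-automorphic of ONE tame
level: along `π_r → ρ` the conductor at the places `v ∈ S`, `v ∤ ℓ`, is bounded by `n + sw_v(ρ)` as soon as `r ≤ 1`, because the wild inertia
`P_v` is pro-`v` (`v ≠ ℓ`): a mod-`𝔪` congruence of traces forces `ρ_r|_{P_v} ≅ ρ|_{P_v}` (Brauer characters of `ℓ'`-groups), so the Swan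
conductor of an approximant is that of `ρ`, and `a_v = codim(inertia invariants) + sw_v ≤ n + sw_v(ρ)` (Artin; JPSS: conductor = level of the
new vector; LLC preserves conductors).  Why it might fail: the comparison needs the Galois avatar of `π_r` with local–global compatibility at
`v` — for irregular or even approximants that is (A) itself; a purely automorphic substitute (bounding the depth of `π_{r,v}` from Satake data
off `S`) is not known.  Sources: Serre–Tate 1968 §1 / Grothendieck (ℓ'-inertia), Carayol 1986 & 1989, Livné 1989, JPSS 1981, Emerton 2011 §1.2. -/
def TameLevelIsolation : Prop :=
  ∀ (K : Type) [Field K] [NumberField K] (n : ℕ) (hcpt : isCompact_glFiniteIntegralLevel n K), 0 < n →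
    ∀ (ℓ : ℕ) [Fact ℓ.Prime] (ι : PadicAlgCl ℓ ≃+* ℂ) (ρ : FramedGaloisRep K (PadicAlgCl ℓ) n),
      ρ.toGaloisRep.IsIrreducible → IsPinnedGeometric ρ → IsProAutomorphic hcpt ι ρ → IsTameLevelProAutomorphic hcpt ι ρ

/-- WLR · WILD LEVEL REMOVAL · crux rank 2 · WEAKER · the residual of LEV · PRINT wherever a `q`-expansion or a model compact at infinity exists
(GL₂/ℚ: Katz 1975, Hida 1986; GL₂ over totally real `F`: Hida 1988; definite unitary / quaternionic settings: density of locally algebraic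
vectors, Chenevier 2004, Emerton 2006) · IDEA-NEEDED for `l₀ > 0` · BARRIER ShimuraVarietyRealization.  Pro-automorphic of tame level `𝔪` ⟹
pro-automorphic of bounded conductor: the wild exponents `e_r` can be bounded at the cost of moving the weights of the approximants (level at `ℓ`
trades against weight `ℓ`-adically).  Why it might fail: for GL_n over a field with `l₀ > 0` (already GL₂ over an imaginary quadratic field) no
principle is known that makes a level-`𝔫𝔭^m` eigensystem a `p`-adic limit of level-`𝔫` eigensystems of other weights — cohomology lives in
several degrees and there is no `q`-expansion; INSTRUMENTABLE on Bianchi newforms. -/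
def WildLevelRemoval : Prop :=
  ∀ (K : Type) [Field K] [NumberField K] (n : ℕ) (hcpt : isCompact_glFiniteIntegralLevel n K), 0 < n →
    ∀ (ℓ : ℕ) [Fact ℓ.Prime] (ι : PadicAlgCl ℓ ≃+* ℂ) (ρ : FramedGaloisRep K (PadicAlgCl ℓ) n),
      ρ.toGaloisRep.IsIrreducible → IsPinnedGeometric ρ → IsTameLevelProAutomorphic hcpt ι ρ → IsLevelBoundedProAutomorphic hcpt ι ρ

/-- PCL · TAME-LEVEL CLASSICALITY · derived cell (= WLR ∧ WT exactly, `tameLevelClassicality_iff`) · UNDECIDED-vs-CLASS · PRINT GL₂/ℚ in exactly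
this shape (Emerton 2011 Thm 1.2.4: `ρ` pro-modular of tame level `N`, de Rham with distinct Hodge–Tate weights ⟹ `ρ ≅ ρ_f`, `f` of level
`Np^m` and weight `k ≥ 2`; Kisin 2003; Pan 2022 = tree fact `Pan2022_proModularDeRhamClassical_GL2Q`) modulo the Eichler–Shimura bridge from
Satake congruences to eigensystems of `𝕋(N)`; Breuil–Hellmann–Schraen 2019 (polarized, crystalline generic, regular) · OPEN-CORE in general ·
BARRIER NonRegularWeight (irregular, n ≥ 3).  Pro-automorphic of tame level `𝔪` and de Rham ⟹ boxed pro-automorphic (level AND weight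
attained in a finite box).  Why it might fail: an irregular de Rham limit of tame-level-`𝔪` forms need not be congruent to all depths to forms
in one finite (level, infinity-type) box — companion-form / weight-cycling phenomena beyond GL₂. -/
def TameLevelClassicality : Prop :=
  ∀ (K : Type) [Field K] [NumberField K] (n : ℕ) (hcpt : isCompact_glFiniteIntegralLevel n K), 0 < n →
    ∀ (ℓ : ℕ) [Fact ℓ.Prime] (ι : PadicAlgCl ℓ ≃+* ℂ) (ρ : FramedGaloisRep K (PadicAlgCl ℓ) n),
      ρ.toGaloisRep.IsIrreducible → IsPinnedGeometric ρ → IsTameLevelProAutomorphic hcpt ι ρ → IsBoxedProAutomorphic hcpt ι ρ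

/-- The optional ASSEMBLY item of the child on LEV: TLI → WLR → LEV (proved: `tameLevelAssembly_proof`; the bare name `Assembly` is registry-owned). -/
def TameLevelAssembly : Prop :=
  TameLevelIsolation → WildLevelRemoval → LevelIsolation

/-! ## 3. Kernel — the dictionary (common-level normal form) and the ladder steps -/

section Kernel

variable {K : Type} [Field K] [NumberField K] {n : ℕ} {ℓ : ℕ} [Fact ℓ.Prime]
  {hcpt : isCompact_glFiniteIntegralLevel n K} {ι : PadicAlgCl ℓ ≃+* ℂ} {ρ : FramedGaloisRep K (PadicAlgCl ℓ) n}

/-- `ℓ𝓞_K ≠ 0`. -/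
theorem ellSpan_ne_zero : (Ideal.span {(ℓ : 𝓞 K)} : Ideal (𝓞 K)) ≠ 0 := by
  rw [Ne, Ideal.zero_eq_bot, Ideal.span_singleton_eq_bot]
  exact_mod_cast (Fact.out : ℓ.Prime).ne_zero

/-- the wild part `(ℓ𝓞_K)^e` of a tame-level datum is a nonzero ideal, so `𝔪·(ℓ)^e ≠ 0` for `𝔪 ≠ 0`. -/
theorem tameWildLevel_ne_zero {𝔪 : Ideal (𝓞 K)} (h𝔪 : 𝔪 ≠ 0) (e : ℕ) : 𝔪 * Ideal.span {(ℓ : 𝓞 K)} ^ e ≠ 0 :=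
  mul_ne_zero h𝔪 (pow_ne_zero e ellSpan_ne_zero)

/-- LEVELS ARE ANTITONE: a form fixed by `K(𝔫)` is fixed by `K(𝔪)` for every nonzero `𝔪 ≤ 𝔫` (tree: `principalCongruenceLevel_mono`). -/
theorem hasLevel_anti {π : CuspidalAutomorphicRepData n K hcpt} {𝔪 𝔫 : Ideal (𝓞 K)} (h : HasLevel π 𝔫) (h𝔪 : 𝔪 ≠ 0) (hle : 𝔪 ≤ 𝔫) :
    HasLevel π 𝔪 := by
  obtain ⟨_, φ, hφW, hφW', hfix⟩ := h
  exact ⟨h𝔪, φ, hφW, hφW', fun u hu => hfix u (principalCongruenceLevel_mono n K h𝔪 hle hu)⟩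

/-- the wild exponent can always be deepened. -/
theorem hasLevel_tameWild_mono {π : CuspidalAutomorphicRepData n K hcpt} {𝔪 : Ideal (𝓞 K)} {e e' : ℕ} (h : HasLevel π (𝔪 * Ideal.span {(ℓ : 𝓞 K)} ^ e))
    (hee' : e ≤ e') : HasLevel π (𝔪 * Ideal.span {(ℓ : 𝓞 K)} ^ e') := by
  have h𝔪 : 𝔪 ≠ 0 := fun h0 => h.1 (by rw [h0, zero_mul])
  exact hasLevel_anti h (tameWildLevel_ne_zero h𝔪 e') (Ideal.mul_mono_right (Ideal.pow_le_pow_right hee'))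

omit [NumberField K] in
/-- COMMON LEVEL: finitely many levels admit ONE nonzero common refinement (the product of the nonzero members). -/
theorem exists_commonLevel {𝔑 : Set (Ideal (𝓞 K))} (h𝔑 : 𝔑.Finite) :
    ∃ 𝔫₀ : Ideal (𝓞 K), 𝔫₀ ≠ 0 ∧ ∀ 𝔫 ∈ 𝔑, 𝔫 ≠ 0 → 𝔫₀ ≤ 𝔫 := by
  classical
  refine ⟨∏ 𝔫 ∈ h𝔑.toFinset.filter (fun 𝔫 => 𝔫 ≠ 0), 𝔫, ?_, fun 𝔫 h𝔫 h0 => ?_⟩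
  · exact Finset.prod_ne_zero_iff.mpr fun 𝔫 h𝔫 => (Finset.mem_filter.mp h𝔫).2
  · exact Ideal.prod_le_inf.trans (Finset.inf_le (Finset.mem_filter.mpr ⟨h𝔑.mem_toFinset.mpr h𝔫, h0⟩))

/-- **DICTIONARY (normal form of C^lev): bounded conductor ⟺ ONE common level.**  «Finitely many levels» (g34's `IsLevelBoundedProAutomorphic`)
is the same as «one open compact subgroup `K(𝔫₀)` fixing a vector of every approximant». -/
theorem levelBounded_iff_commonLevel : IsLevelBoundedProAutomorphic hcpt ι ρ ↔
    ∃ S : Set (HeightOneSpectrum (𝓞 K)), S.Finite ∧ ∃ 𝔫₀ : Ideal (𝓞 K), 𝔫₀ ≠ 0 ∧ ∀ r : NNReal, 0 < r →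
      ∃ π : CuspidalAutomorphicRepData n K hcpt, π.1.IsLAlgebraic ∧ HasLevel π 𝔫₀ ∧
        ∀ v : HeightOneSpectrum (𝓞 K), v ∉ S → CloseAt ι π ρ r v := by
  constructor
  · rintro ⟨S, hS, 𝔑, h𝔑, h⟩
    obtain ⟨𝔫₀, h𝔫₀, hle⟩ := exists_commonLevel h𝔑
    refine ⟨S, hS, 𝔫₀, h𝔫₀, fun r hr => ?_⟩
    obtain ⟨π, hπ, ⟨𝔫, h𝔫𝔑, hlev⟩, hclose⟩ := h r hr
    exact ⟨π, hπ, hasLevel_anti hlev h𝔫₀ (hle 𝔫 h𝔫𝔑 hlev.1), hclose⟩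
  · rintro ⟨S, hS, 𝔫₀, _h𝔫₀, h⟩
    refine ⟨S, hS, {𝔫₀}, Set.finite_singleton 𝔫₀, fun r hr => ?_⟩
    obtain ⟨π, hπ, hlev, hclose⟩ := h r hr
    exact ⟨π, hπ, ⟨𝔫₀, Set.mem_singleton 𝔫₀, hlev⟩, hclose⟩

/-- DOWN: bounded conductor ⟹ tame level (the common level with wild exponent `0`) — the step that makes LEV ⟹ TLI. -/
theorem tame_of_levelBounded (h : IsLevelBoundedProAutomorphic hcpt ι ρ) : IsTameLevelProAutomorphic hcpt ι ρ := by
  obtain ⟨S, hS, 𝔫₀, h𝔫₀, h⟩ := levelBounded_iff_commonLevel.mp h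
  refine ⟨S, hS, 𝔫₀, h𝔫₀, fun r hr => ?_⟩
  obtain ⟨π, hπ, hlev, hclose⟩ := h r hr
  refine ⟨π, hπ, ⟨0, ?_⟩, hclose⟩
  rw [pow_zero, mul_one]
  exact hlev

/-- DOWN: tame level ⟹ C (forget the level; the target's hypothesis). -/
theorem pro_of_tame (h : IsTameLevelProAutomorphic hcpt ι ρ) : IsProAutomorphic hcpt ι ρ := by
  obtain ⟨S, hS, _𝔪, _h𝔪, h⟩ := h
  refine ⟨S, hS, fun r hr => ?_⟩
  obtain ⟨π, hπ, _hlev, hclose⟩ := h r hr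
  exact ⟨π, hπ, hclose⟩

/-- DOWN: boxed ⟹ tame level. -/
theorem tame_of_boxed (h : IsBoxedProAutomorphic hcpt ι ρ) : IsTameLevelProAutomorphic hcpt ι ρ :=
  tame_of_levelBounded (BoxCapture.levelBounded_of_boxed h)

end Kernel

/-! ## 4. THE EQUIV and the exact splits -/

/-- LEV ⟹ TLI (through the common-level normal form). -/
theorem tli_of_lev (h : LevelIsolation) : TameLevelIsolation :=
  fun K _ _ n hcpt hn ℓ _ ι ρ hirr hgeo hC => tame_of_levelBounded (h K n hcpt hn ℓ ι ρ hirr hgeo hC)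

/-- LEV ⟹ WLR. -/
theorem wlr_of_lev (h : LevelIsolation) : WildLevelRemoval :=
  fun K _ _ n hcpt hn ℓ _ ι ρ hirr hgeo hT => h K n hcpt hn ℓ ι ρ hirr hgeo (pro_of_tame hT)

/-- TLI ∧ WLR ⟹ LEV (composition). -/
theorem lev_of_tameWild (h₁ : TameLevelIsolation) (h₂ : WildLevelRemoval) : LevelIsolation :=
  fun K _ _ n hcpt hn ℓ _ ι ρ hirr hgeo hC => h₂ K n hcpt hn ℓ ι ρ hirr hgeo (h₁ K n hcpt hn ℓ ι ρ hirr hgeo hC)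

/-- **THE ONE EQUIV (modulo nothing): LEV ⟺ TLI ∧ WLR** — level isolation is tame isolation followed by wild removal. -/
theorem levelIsolation_iff_tameWild : LevelIsolation ↔ TameLevelIsolation ∧ WildLevelRemoval :=
  ⟨fun h => ⟨tli_of_lev h, wlr_of_lev h⟩, fun h => lev_of_tameWild h.1 h.2⟩

/-- PCL ⟹ WLR. -/
theorem wlr_of_pcl (h : TameLevelClassicality) : WildLevelRemoval :=
  fun K _ _ n hcpt hn ℓ _ ι ρ hirr hgeo hT => BoxCapture.levelBounded_of_boxed (h K n hcpt hn ℓ ι ρ hirr hgeo hT)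

/-- PCL ⟹ WT. -/
theorem wt_of_pcl (h : TameLevelClassicality) : WeightIsolation :=
  fun K _ _ n hcpt hn ℓ _ ι ρ hirr hgeo hL => h K n hcpt hn ℓ ι ρ hirr hgeo (tame_of_levelBounded hL)

/-- WLR ∧ WT ⟹ PCL (composition). -/
theorem pcl_of_wlr_wt (h₁ : WildLevelRemoval) (h₂ : WeightIsolation) : TameLevelClassicality :=
  fun K _ _ n hcpt hn ℓ _ ι ρ hirr hgeo hT => h₂ K n hcpt hn ℓ ι ρ hirr hgeo (h₁ K n hcpt hn ℓ ι ρ hirr hgeo hT)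

/-- **EXACT: PCL ⟺ WLR ∧ WT** — the print theorem's shape is wild removal plus weight isolation. -/
theorem tameLevelClassicality_iff : TameLevelClassicality ↔ WildLevelRemoval ∧ WeightIsolation :=
  ⟨fun h => ⟨wlr_of_pcl h, wt_of_pcl h⟩, fun h => pcl_of_wlr_wt h.1 h.2⟩

/-- **EXACT RE-ASSOCIATION of CLASS BY NAME: CLASS ⟺ TLI ∧ PCL ∧ HC** (beside g34's CLASS ⟺ LEV ∧ WT ∧ HC). -/
theorem classicality_iff_tameCells :
    DepthPrimeSplit.Classicality ↔ TameLevelIsolation ∧ TameLevelClassicality ∧ HarishChandraCapture :=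
  BoxCapture.classicality_iff_cells.trans
    ⟨fun h => ⟨tli_of_lev h.1, pcl_of_wlr_wt (wlr_of_lev h.1) h.2.1, h.2.2⟩,
      fun h => ⟨lev_of_tameWild h.1 (wlr_of_pcl h.2.1), wt_of_pcl h.2.1, h.2.2⟩⟩

/-- **THE FOUR-RUNG LADDER: CLASS ⟺ TLI ∧ WLR ∧ WT ∧ HC** (common refinement of both three-cell cuts). -/
theorem classicality_iff_fourRungs :
    DepthPrimeSplit.Classicality ↔ TameLevelIsolation ∧ WildLevelRemoval ∧ WeightIsolation ∧ HarishChandraCapture :=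
  BoxCapture.classicality_iff_cells.trans
    ⟨fun h => ⟨tli_of_lev h.1, wlr_of_lev h.1, h.2.1, h.2.2⟩, fun h => ⟨lev_of_tameWild h.1 h.2.1, h.2.2.1, h.2.2.2⟩⟩

/-- each new cell is necessary: CLASS ⟹ TLI. -/
theorem tli_of_classicality (h : DepthPrimeSplit.Classicality) : TameLevelIsolation :=
  (classicality_iff_fourRungs.mp h).1

/-- CLASS ⟹ WLR. -/
theorem wlr_of_classicality (h : DepthPrimeSplit.Classicality) : WildLevelRemoval :=
  (classicality_iff_fourRungs.mp h).2.1

/-- CLASS ⟹ PCL. -/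
theorem pcl_of_classicality (h : DepthPrimeSplit.Classicality) : TameLevelClassicality :=
  (classicality_iff_tameCells.mp h).2.1

/-! ## 5. ROOT-IMPLIED certificate (no EXCESS): the summit implies every new piece -/

/-- `Langlands ⟹ TLI ∧ WLR ∧ PCL` (through g34's `cells_of_langlands` and the kernel). -/
theorem tameCells_of_langlands (hL : _root_.Langlands) : TameLevelIsolation ∧ WildLevelRemoval ∧ TameLevelClassicality :=
  have h := BoxCapture.cells_of_langlands hL
  ⟨tli_of_lev h.1, wlr_of_lev h.1, pcl_of_wlr_wt (wlr_of_lev h.1) h.2.1⟩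

/-! ## 6. The frames BY NAME -/

/-- **closes (child on LEV = `BoxCapture.LevelIsolation`):** TLI → WLR → LEV. -/
theorem closes_levelIsolation (h₁ : TameLevelIsolation) (h₂ : WildLevelRemoval) : LevelIsolation :=
  lev_of_tameWild h₁ h₂

/-- the optional assembly item, proved. -/
theorem tameLevelAssembly_proof : TameLevelAssembly := closes_levelIsolation

/-- **closes (re-associated child on CLASS stmt-Langlands-25026):** TLI → PCL → HC → `DepthPrimeSplit.Classicality`. -/
theorem closes_classicality_tame (h₁ : TameLevelIsolation) (h₂ : TameLevelClassicality) (h₃ : HarishChandraCapture) :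
    DepthPrimeSplit.Classicality :=
  classicality_iff_tameCells.mpr ⟨h₁, h₂, h₃⟩

/-- **closes_root:** the host route's deciding theorem `DepthPrimeSplit.closes` with CLASS replaced by TLI, PCL, HC. -/
theorem closes_root_tame (hD : DepthPrimeSplit.DyadicSeed) (hO : DepthPrimeSplit.OddPrimeSeed) (hF : DepthPrimeSplit.FernSpread)
    (h₁ : TameLevelIsolation) (h₂ : TameLevelClassicality) (h₃ : HarishChandraCapture) (hW : DepthPrimeSplit.SatakeAvatarExistence)
    (hP : DepthPrimeSplit.PadicMemberCompatibility) (hA : DepthPrimeSplit.CompatibilityAwayFromLR)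
    (hR : DepthPrimeSplit.CanonicalReciprocityData) : _root_.Langlands :=
  DepthPrimeSplit.closes hD hO hF (closes_classicality_tame h₁ h₂ h₃) hW hP hA hR

end Summit.Langlands.Langlands.Theorems.TameLevelSplit
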